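import Mathlib
import HarnessLib
import Summits.Ventures.LatticeQCDFlow.Exactness.SphereBodyFrameLeapfrog
import Summits.Ventures.LatticeQCDFlow.Exactness.KickedProductTrajectory

/-!
# The sphere leapfrog IS a kicked product in the operator algebra: `V ← e^{−δA(e,q)}·V`, `q ← q + (δ/2)·V F(V† e)`, and the standing hypotheses `PLFBounds` hold with `C = 1`

HONEST FRAMING: exact (Metropolis-corrected) sampling algorithms for lattice gauge theory;
figures of merit are autocorrelation/cost numbers at stated couplings and volumes; no
continuum-physics claim.

Venture `LatticeQCDFlow` (cell pub-lqcd), topic `Exactness`, FANOUT row 9 (eng-latcore; roadmap Step 1 to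
multi-step HMC on the `cpn_2d` sphere family, HOME/eng-latcore/HANDOFF.md GEN-19).  NEW WORK of the cell over
the tree (gen-18's `KickedProductTrajectory.lean`: `plfStep`, `plfTraj`, `PLFBounds` — the abstract
kicked-product system in ANY real normed algebra; `SphereBodyFrameLeapfrog.lean` and its imports: `geodGen`,
`norm_exp_geodGen`, `geodRotEquiv`, `isoFrame`, `bfKick`, `bfDrift`, `bfLeapfrog`) and Mathlib
(`ContinuousLinearMap.adjoint`, `LinearIsometryEquiv.adjoint_eq_symm`, `hasStrictFDerivAt_exp_zero`,
`exp_add_of_commute_of_mem_ball`); nothing is cited as a fact; no number.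

THE POINT.  In the algebra `𝔸 = E →L[ℝ] E` (`E = ℝ^m`, operator norm, complete) write the INVERSE frame
`V = W⁻¹` (a continuous linear map).  Then the body-frame letters of `SphereBodyFrameLeapfrog.lean` read
* drift: `V ← e^{δ·J q} · V` with `J q = −A(e, q)` — `J = geodGenNegL e : E →L[ℝ] 𝔸` is LINEAR;
* half kick: `q ← q + G V`, `G V = (δ/2) · V (F (V† e))` (`V† = adjoint V = W` on frames);
i.e. EXACTLY gen-18's `plfStep exp J G δ` (**`opFrame_bfLeapfrog`**), and the standing hypotheses
`PLFBounds exp J G T 1 b' K' ρ η` hold with `T` = the ISOMETRIES of `E` (`‖V y‖ = ‖y‖`; stable because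
`e^{−δA}` is an isometry — `norm_exp_geodGen`; norm `≤ 1`), the exponential's `η`-defect from strict
differentiability at `0`, and `G` bounded by `|δ/2|·sup‖F‖` and Lipschitz with constant
`|δ/2|·(sup‖F‖ + Lip F·‖e‖)` in the operator norm (**`plfBounds_sphere`**).  Hence gen-18's two-point
estimate `plfTraj_fst_approx` applies verbatim to the sphere trajectory (roadmap Step 2 reads the
position `V_n† e` out of it).

* §1 `geodGenNegL e` (`q ↦ −A(e,q)` as a CLM into `𝔸`; `norm_geodGen_le`: `‖A(e,q)‖ ≤ 2‖e‖‖q‖`),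
  `isoSet` (+ `one_mem`, `norm_le_one`, `exp_smul_geodGen_mul_mem`), `exists_opExp_defect`.
* §2 `bodyKickOp F c e V = c • V (F (V† e))`: `norm_bodyKickOp_le`, `bodyKickOp_lipschitz`;
  **`plfBounds_sphere`**.
* §3 `opFrame (W, q) = ((W⁻¹ : 𝔸), q)`; `geodRotEquiv_symm_apply` (`(e^{δA})⁻¹ = e^{−δA}`),
  `opFrame_bfKick`, `opFrame_bfDrift`, **`opFrame_bfLeapfrog`** (`opFrame ∘ bfLeapfrog = plfStep ∘ opFrame`),
  **`opFrame_bfLeapfrog_iterate`** (`n` steps from the identity frame: `opFrame (bfLeapfrog^[n] (refl, p))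
  = (plfStep)^[n] (1, p)`).

NOT CLAIMED: the position law / chart / threshold / ergodicity (roadmap Steps 2–5); families (sitewise, the
algebra `Π_i (E_i →L E_i)`); constants beyond the displayed ones.
-/

noncomputable section

namespace Summit.Ventures.LatticeQCDFlow.Exactness

open NormedSpace Metric Function Set Filter Topology
open scoped InnerProductSpace NNReal

variable {m : Type*} [Fintype m]

/-! ## §1 The generator as a linear map into the algebra; isometries; the exponential's defect -/

section Algebra

/-- `‖A(e, q)‖ ≤ 2‖e‖‖q‖` (operator norm). -/
theorem norm_geodGen_le (e q : EuclideanSpace ℝ m) : ‖geodGen e q‖ ≤ 2 * ‖e‖ * ‖q‖ := by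
  refine ContinuousLinearMap.opNorm_le_bound _ (by positivity) fun y => ?_
  rw [geodGen_apply]
  calc ‖⟪e, y⟫_ℝ • q - ⟪q, y⟫_ℝ • e‖ ≤ ‖⟪e, y⟫_ℝ • q‖ + ‖⟪q, y⟫_ℝ • e‖ := norm_sub_le _ _
    _ ≤ ‖e‖ * ‖y‖ * ‖q‖ + ‖q‖ * ‖y‖ * ‖e‖ := by
        rw [norm_smul, norm_smul, Real.norm_eq_abs, Real.norm_eq_abs]
        exact add_le_add (mul_le_mul_of_nonneg_right (abs_real_inner_le_norm _ _) (norm_nonneg _))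
          (mul_le_mul_of_nonneg_right (abs_real_inner_le_norm _ _) (norm_nonneg _))
    _ = 2 * ‖e‖ * ‖q‖ * ‖y‖ := by ring

/-- **`J_e : q ↦ −A(e, q)`**, a continuous linear map from the momenta into the algebra `E →L[ℝ] E`. -/
def geodGenNegL (e : EuclideanSpace ℝ m) : EuclideanSpace ℝ m →L[ℝ] (EuclideanSpace ℝ m →L[ℝ] EuclideanSpace ℝ m) :=
  LinearMap.toContinuousLinearMap
    { toFun := fun q => -geodGen e q
      map_add' := fun q q' => by
        refine ContinuousLinearMap.ext fun y => ?_
        show -(geodGen e (q + q') y) = -(geodGen e q y) + -(geodGen e q' y)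
        simp only [geodGen_apply, inner_add_left]
        module
      map_smul' := fun c q => by
        refine ContinuousLinearMap.ext fun y => ?_
        show -(geodGen e (c • q) y) = c • -(geodGen e q y)
        simp only [geodGen_apply, real_inner_smul_left]
        module }

/-- Pointwise. -/
@[simp] theorem geodGenNegL_apply (e q : EuclideanSpace ℝ m) : geodGenNegL e q = -geodGen e q := rfl

/-- **The isometries of `E`** as a subset of the algebra. -/
def isoSet : Set (EuclideanSpace ℝ m →L[ℝ] EuclideanSpace ℝ m) := {V | ∀ y, ‖V y‖ = ‖y‖}

/-- Membership. -/
theorem mem_isoSet {V : EuclideanSpace ℝ m →L[ℝ] EuclideanSpace ℝ m} : V ∈ isoSet ↔ ∀ y, ‖V y‖ = ‖y‖ := Iff.rfl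

/-- `1 ∈ isoSet`. -/
theorem one_mem_isoSet : (1 : EuclideanSpace ℝ m →L[ℝ] EuclideanSpace ℝ m) ∈ isoSet := fun _ => rfl

/-- Isometries have operator norm `≤ 1`. -/
theorem norm_le_one_of_mem_isoSet {V : EuclideanSpace ℝ m →L[ℝ] EuclideanSpace ℝ m} (hV : V ∈ isoSet) : ‖V‖ ≤ 1 :=
  ContinuousLinearMap.opNorm_le_bound _ zero_le_one fun y => by rw [hV y, one_mul]

/-- `e^{J_e v} · V` is an isometry when `V` is (`e^{−A(e,v)}` is norm-preserving). -/
theorem exp_geodGenNegL_mul_mem_isoSet (e v : EuclideanSpace ℝ m) {V : EuclideanSpace ℝ m →L[ℝ] EuclideanSpace ℝ m}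
    (hV : V ∈ isoSet) : exp (geodGenNegL e v) * V ∈ isoSet := fun y => by
  show ‖exp (geodGenNegL e v) (V y)‖ = ‖y‖
  rw [geodGenNegL_apply, show -geodGen e v = (-1 : ℝ) • geodGen e v by rw [neg_one_smul], norm_exp_geodGen, hV y]

/-- **The exponential of the operator algebra has the `η`-defect property near `0`** for every `η > 0`. -/
theorem exists_opExp_defect {η : ℝ} (hη : 0 < η) :
    ∃ ρ : ℝ, 0 < ρ ∧ ∀ a a' : EuclideanSpace ℝ m →L[ℝ] EuclideanSpace ℝ m, ‖a‖ ≤ ρ → ‖a'‖ ≤ ρ →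
      ‖exp a - exp a' - (a - a')‖ ≤ η * ‖a - a'‖ := by
  have hc : (0 : ℝ≥0) < ⟨η, hη.le⟩ := by rw [← NNReal.coe_lt_coe]; exact hη
  obtain ⟨s, hs, happ⟩ := (hasStrictFDerivAt_exp_zero (𝕂 := ℝ)
    (𝔸 := EuclideanSpace ℝ m →L[ℝ] EuclideanSpace ℝ m)).approximates_deriv_on_nhds (c := ⟨η, hη.le⟩) (Or.inr hc)
  obtain ⟨ρ₀, hρ₀, hball⟩ := Metric.mem_nhds_iff.1 hs
  refine ⟨ρ₀ / 2, half_pos hρ₀, fun a a' ha ha' => ?_⟩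
  have hmem : ∀ b : EuclideanSpace ℝ m →L[ℝ] EuclideanSpace ℝ m, ‖b‖ ≤ ρ₀ / 2 → b ∈ s := fun b hb =>
    hball (mem_ball_zero_iff.2 (lt_of_le_of_lt hb (by linarith)))
  have h0 := happ a (hmem a ha) a' (hmem a' ha')
  change ‖exp a - exp a' - (a - a')‖ ≤ η * ‖a - a'‖ at h0
  exact h0

end Algebra

/-! ## §2 The body-frame half kick in the algebra and the standing hypotheses -/

section Bounds

variable (F : EuclideanSpace ℝ m → EuclideanSpace ℝ m) (c : ℝ) (e : EuclideanSpace ℝ m)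

/-- **The half kick read in the algebra**: `G V = c • V (F (V† e))` (`V† e` is the position when `V = W⁻¹`). -/
def bodyKickOp (V : EuclideanSpace ℝ m →L[ℝ] EuclideanSpace ℝ m) : EuclideanSpace ℝ m :=
  c • V (F (ContinuousLinearMap.adjoint V e))

variable {F c e} {b KF : ℝ}

/-- `‖G V‖ ≤ |c| b` on isometries. -/
theorem norm_bodyKickOp_le (hFb : ∀ x, ‖F x‖ ≤ b) {V : EuclideanSpace ℝ m →L[ℝ] EuclideanSpace ℝ m}
    (hV : V ∈ isoSet) : ‖bodyKickOp F c e V‖ ≤ |c| * b := by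
  rw [bodyKickOp, norm_smul, Real.norm_eq_abs, hV]
  exact mul_le_mul_of_nonneg_left (hFb _) (abs_nonneg _)

/-- `G` is Lipschitz on isometries in the operator norm, constant `|c| (b + K_F ‖e‖)`. -/
theorem bodyKickOp_lipschitz (hFb : ∀ x, ‖F x‖ ≤ b) (hK0 : 0 ≤ KF) (hFK : ∀ x x', ‖F x - F x'‖ ≤ KF * ‖x - x'‖)
    {V V' : EuclideanSpace ℝ m →L[ℝ] EuclideanSpace ℝ m} (_hV : V ∈ isoSet) (hV' : V' ∈ isoSet) :
    ‖bodyKickOp F c e V - bodyKickOp F c e V'‖ ≤ |c| * (b + KF * ‖e‖) * ‖V - V'‖ := by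
  have hb0 : 0 ≤ b := (norm_nonneg _).trans (hFb 0)
  set x := ContinuousLinearMap.adjoint V e with hx
  set x' := ContinuousLinearMap.adjoint V' e with hx'
  have hxx' : ‖x - x'‖ ≤ ‖V - V'‖ * ‖e‖ := by
    have hsub : x - x' = (ContinuousLinearMap.adjoint (V - V')) e := by
      rw [hx, hx', map_sub]; rfl
    rw [hsub]
    exact (ContinuousLinearMap.le_opNorm _ _).trans (by rw [LinearIsometryEquiv.norm_map])
  have h1 : ‖V (F x) - V' (F x')‖ ≤ (b + KF * ‖e‖) * ‖V - V'‖ := by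
    calc ‖V (F x) - V' (F x')‖ = ‖(V - V') (F x) + V' (F x - F x')‖ := by
          congr 1
          show V (F x) - V' (F x') = (V (F x) - V' (F x)) + V' (F x - F x')
          rw [map_sub]; abel
      _ ≤ ‖(V - V') (F x)‖ + ‖V' (F x - F x')‖ := norm_add_le _ _
      _ ≤ ‖V - V'‖ * b + KF * (‖V - V'‖ * ‖e‖) := by
          refine add_le_add ((ContinuousLinearMap.le_opNorm _ _).trans (mul_le_mul_of_nonneg_left (hFb x) (norm_nonneg _))) ?_
          rw [hV']
          exact (hFK x x').trans (mul_le_mul_of_nonneg_left hxx' hK0)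
      _ = (b + KF * ‖e‖) * ‖V - V'‖ := by ring
  rw [bodyKickOp, bodyKickOp, ← smul_sub, norm_smul, Real.norm_eq_abs, mul_assoc]
  exact mul_le_mul_of_nonneg_left h1 (abs_nonneg _)

/-- **THE STANDING HYPOTHESES OF THE KICKED-PRODUCT ANALYSIS HOLD FOR THE SPHERE LEAPFROG**: with
`T` = isometries, `C = 1`, the body-frame half kick bounded by `|c| b` and Lipschitz with constant
`|c|(b + K_F‖e‖)`, and the exponential's `η`-defect radius `ρ`. -/
theorem plfBounds_sphere (hFb : ∀ x, ‖F x‖ ≤ b) (hK0 : 0 ≤ KF) (hFK : ∀ x x', ‖F x - F x'‖ ≤ KF * ‖x - x'‖)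
    {ρ η : ℝ} (hρ : 0 < ρ) (hη0 : 0 ≤ η) (hη1 : η ≤ 1)
    (hdef : ∀ a a' : EuclideanSpace ℝ m →L[ℝ] EuclideanSpace ℝ m, ‖a‖ ≤ ρ → ‖a'‖ ≤ ρ →
      ‖exp a - exp a' - (a - a')‖ ≤ η * ‖a - a'‖) :
    PLFBounds exp (geodGenNegL e) (bodyKickOp F c e) isoSet 1 (|c| * b) (|c| * (b + KF * ‖e‖)) ρ η where
  one_mem := one_mem_isoSet
  mul_mem := fun v V hV => exp_geodGenNegL_mul_mem_isoSet e v hV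
  norm_le := fun V hV => norm_le_one_of_mem_isoSet hV
  one_le := le_rfl
  force_le := fun V hV => norm_bodyKickOp_le hFb hV
  force_lip := fun V hV V' hV' => bodyKickOp_lipschitz hFb hK0 hFK hV hV'
  lip_nonneg := by
    have hb0 : 0 ≤ b := (norm_nonneg _).trans (hFb 0)
    positivity
  ex_zero := NormedSpace.exp_zero
  ex_defect := hdef
  defect_nonneg := hη0
  defect_le_one := hη1
  radius_nonneg := hρ.le

end Bounds

/-! ## §3 The dictionary: inverse frames follow `plfStep` -/

section Dictionary

/-- **The inverse frame read in the algebra**: `(W, q) ↦ (W⁻¹ as a continuous linear map, q)`. -/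
def opFrame (w : (EuclideanSpace ℝ m ≃ₗᵢ[ℝ] EuclideanSpace ℝ m) × EuclideanSpace ℝ m) :
    (EuclideanSpace ℝ m →L[ℝ] EuclideanSpace ℝ m) × EuclideanSpace ℝ m :=
  ((w.1.symm : EuclideanSpace ℝ m →L[ℝ] EuclideanSpace ℝ m), w.2)

/-- Components. -/
@[simp] theorem opFrame_fst_apply (w : (EuclideanSpace ℝ m ≃ₗᵢ[ℝ] EuclideanSpace ℝ m) × EuclideanSpace ℝ m)
    (y : EuclideanSpace ℝ m) : (opFrame w).1 y = w.1.symm y := rfl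

/-- Components. -/
@[simp] theorem opFrame_snd (w : (EuclideanSpace ℝ m ≃ₗᵢ[ℝ] EuclideanSpace ℝ m) × EuclideanSpace ℝ m) :
    (opFrame w).2 = w.2 := rfl

/-- The identity frame reads as `1`. -/
theorem opFrame_refl (q : EuclideanSpace ℝ m) :
    opFrame (LinearIsometryEquiv.refl ℝ (EuclideanSpace ℝ m), q) = (1, q) := by
  refine Prod.ext (ContinuousLinearMap.ext fun y => rfl) rfl

/-- **`(e^{δA})⁻¹ = e^{−δA}`** on vectors: the inverse of the rotation equivalence. -/
theorem geodRotEquiv_symm_apply (x p y : EuclideanSpace ℝ m) (t : ℝ) :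
    (geodRotEquiv x p t).symm y = exp (-(t • geodGen x p)) y := by
  set A := geodGen x p with hA
  have hrad : ∀ z : EuclideanSpace ℝ m →L[ℝ] EuclideanSpace ℝ m,
      z ∈ Metric.eball (0 : EuclideanSpace ℝ m →L[ℝ] EuclideanSpace ℝ m)
        (expSeries ℝ (EuclideanSpace ℝ m →L[ℝ] EuclideanSpace ℝ m)).radius := fun z => by
    rw [expSeries_radius_eq_top]; exact edist_lt_top _ _
  have hprod : exp (t • A) * exp (-(t • A)) = 1 := by
    rw [← exp_add_of_commute_of_mem_ball ((Commute.refl (t • A)).neg_right) (hrad _) (hrad _), add_neg_cancel,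
      NormedSpace.exp_zero]
  apply (geodRotEquiv x p t).injective
  rw [LinearIsometryEquiv.apply_symm_apply, geodRotEquiv_apply, ← hA]
  show y = (exp (t • A) * exp (-(t • A))) y
  rw [hprod]
  rfl

variable (e : sphere (0 : EuclideanSpace ℝ m) 1) (F : EuclideanSpace ℝ m → EuclideanSpace ℝ m) (δ : ℝ)

/-- The kick in the algebra: `opFrame (bfKick F c e (W, q)) = (V, q + G V)` with `G = bodyKickOp F c e`. -/
theorem opFrame_bfKick (c : ℝ) (w : (EuclideanSpace ℝ m ≃ₗᵢ[ℝ] EuclideanSpace ℝ m) × EuclideanSpace ℝ m) :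
    opFrame (bfKick F c e w) = ((opFrame w).1, (opFrame w).2 + bodyKickOp F c (e : EuclideanSpace ℝ m) (opFrame w).1) := by
  refine Prod.ext rfl ?_
  simp only [opFrame, bfKick, bodyKickOp]
  congr 2
  rw [LinearIsometryEquiv.adjoint_eq_symm, LinearIsometryEquiv.symm_symm]
  rfl

/-- The drift in the algebra: `opFrame (bfDrift δ e (W, q)) = (exp (δ • J q) * V, q)`. -/
theorem opFrame_bfDrift (w : (EuclideanSpace ℝ m ≃ₗᵢ[ℝ] EuclideanSpace ℝ m) × EuclideanSpace ℝ m) :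
    opFrame (bfDrift δ e w) = (exp (δ • geodGenNegL (e : EuclideanSpace ℝ m) (opFrame w).2) * (opFrame w).1, (opFrame w).2) := by
  refine Prod.ext (ContinuousLinearMap.ext fun y => ?_) rfl
  show ((geodRotEquiv (e : EuclideanSpace ℝ m) w.2 δ).trans w.1).symm y =
    (exp (δ • geodGenNegL (e : EuclideanSpace ℝ m) w.2)) (w.1.symm y)
  rw [LinearIsometryEquiv.symm_trans, LinearIsometryEquiv.trans_apply, geodRotEquiv_symm_apply, geodGenNegL_apply,
    smul_neg]

/-- **THE SPHERE LEAPFROG STEP IS gen-18's `plfStep` IN THE OPERATOR ALGEBRA**: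
`opFrame ∘ bfLeapfrog e F δ = plfStep exp J_e G δ ∘ opFrame` with `G = bodyKickOp F (δ/2) e`. -/
theorem opFrame_bfLeapfrog (w : (EuclideanSpace ℝ m ≃ₗᵢ[ℝ] EuclideanSpace ℝ m) × EuclideanSpace ℝ m) :
    opFrame (bfLeapfrog e F δ w) =
      plfStep exp (geodGenNegL (e : EuclideanSpace ℝ m)) (bodyKickOp F (δ / 2) (e : EuclideanSpace ℝ m)) δ (opFrame w) := by
  rw [bfLeapfrog, opFrame_bfKick, opFrame_bfDrift, opFrame_bfKick, plfStep]

/-- **`n` leapfrog steps from the identity frame are `n` steps of `plfStep` from `(1, p)`** — so the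
trajectory estimates of `KickedProductTrajectory.lean` / `KickedProductTwoPoint.lean` apply to the sphere. -/
theorem opFrame_bfLeapfrog_iterate (p : EuclideanSpace ℝ m) (n : ℕ) :
    opFrame ((bfLeapfrog e F δ)^[n] (LinearIsometryEquiv.refl ℝ (EuclideanSpace ℝ m), p)) =
      (plfStep exp (geodGenNegL (e : EuclideanSpace ℝ m)) (bodyKickOp F (δ / 2) (e : EuclideanSpace ℝ m)) δ)^[n] (1, p) := by
  have h : Semiconj opFrame (bfLeapfrog e F δ)
      (plfStep exp (geodGenNegL (e : EuclideanSpace ℝ m)) (bodyKickOp F (δ / 2) (e : EuclideanSpace ℝ m)) δ) :=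
    fun w => opFrame_bfLeapfrog e F δ w
  rw [(h.iterate_right n).eq, opFrame_refl]

end Dictionary

end Summit.Ventures.LatticeQCDFlow.Exactness
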